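import Literature.NumberTheory.EllipticCurves.Kato2004.AdditivePotGoodRankZeroShaUpperBoundFineSelmerAtTwoSharp
import Literature.NumberTheory.EllipticCurves.QuadraticTwist
import Literature.NumberTheory.EllipticCurves.PAdicHeights
import HarnessLib

/-!
# Kato 2004 at `p = 2`, SHARP form, at an ADDITIVE `2` — potentially good OR potentially multiplicative — for IRREDUCIBLE `E[2]`, granted Coates–Sujatha's statement (A) at `(E, 2)`, under «no quadratic twist of `E` by `−1`, `2` or `−2` is SPLIT multiplicative at `2`»: `ord₂ #Ш(E/ℚ)[2^∞] + v₂(Tam E) ≤ ord₂(L(E,1)/Ω_E)` (ONE named fact; a READING of Kato's proofs at `p = 2`; strictly more general than the potentially-good SHARP reading)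

Topic `NumberTheory/EllipticCurves`, sub-directory `Kato2004` (namespace = path). ONE named fact
(`def … : Prop`, D-0014), nothing else. It GENERALISES the sharp reading
`Kato2004.rankZero_padicValNat_sha_add_padicValNat_tamagawa_le_at_two_of_irreducible_of_fineSelmerDual_fg`
(file `Kato2004/AdditivePotGoodRankZeroShaUpperBoundFineSelmerAtTwoSharp.lean`; steps T1–T14 and the
`Δ`-free append T1′–T7′ are in that file and its predecessor
`Kato2004/AdditivePotGoodRankZeroShaUpperBoundFineSelmerAtTwo.lean` and are NOT repeated) by REPLACING its
hypothesis «potentially good reduction at `2`» (`0 ≤ ord₂ j(E)`) by the hypothesis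

  (NST) no quadratic twist `E^{(d)}`, `d ∈ {−1, 2, −2}`, has SPLIT multiplicative reduction at `2`,

which every additive potentially good curve satisfies (a twist of a potentially good curve is potentially good,
`j(E^{(d)}) = j(E)`, and multiplicative reduction forces `|j|₂ > 1`, Silverman *AEC* VII.5.1 (b)) and which,
among the additive POTENTIALLY MULTIPLICATIVE curves at `2` (`ord₂ j(E) < 0`), singles out those whose
semistable quadratic twist at `2` is NON-SPLIT multiplicative or is the twist by an odd `d`-class other than
`−1, ±2` (lane A census of the cell `bsd-2adic`, rank-`0` additive-at-`2` residue: of 463 potentially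
multiplicative classes, 219 satisfy (NST) — semistabilising class `d* = −1` non-split 138, `d* = 2` non-split 41,
`d* = −2` non-split 40 — and 244 do not; the census is context, not part of the fact). WHY THIS IS THE RIGHT
HYPOTHESIS: in the fourteen steps T1–T14 (and T1′–T7′) the potentially-good hypothesis is used at EXACTLY ONE
place — step T3 (= item 7 of the odd-`p` sibling), where Kato's Thm. 12.5 (3) is applied WITHOUT its local term
`𝐇²_loc`: «(the local term `𝐇²_loc` of 12.5 (3) is `0` at a potentially good `p`, (12.5.1))». Kato's own proof
13.13 computes that local term for every `f`: its Pontryagin dual is the group of `2`-power torsion points of `E`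
over `ℚ₂(ζ_{2^∞})`, and for an ADDITIVE curve at `2` that group is finite exactly under (NST) (Tate's
uniformisation, T15 below). Every other step is insensitive to the distinction potentially good / potentially
multiplicative among ADDITIVE curves (checked one by one in «the other steps» below). Written by the prover seat
`bsd-2adic-addL2x` GEN 13 (cell `bsd-2adic`, rung K4, crux stmt-BirchSwinnertonDyer-19098
`AdditiveRankZeroAtTwo`, split v2.2 child C4″ stmt-BirchSwinnertonDyer-22618 `AdditivePotMultOverKAtTwo`, whose
habitat is the potentially multiplicative sub-block), continuing GEN 5/8's readings; repair-census entry R-B71.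
Flag for the referee (reading audit wanted, lit-kato format):
`Kato-12.4(2)-12.5(1)(3)-12.6-13.8-13.13-13.14-14.14-at-two-additive-noSplitCycTwist-irreducible-fineSelmer-fg-sharp`.

## Notation

As in the two earlier files: `E/ℚ` non-CM, globally minimal `W`, ADDITIVE at `2` (Kodaira type not `I₀`, not
`I_n`), `E[2]` irreducible, `L(E,1) ≠ 0`, `Ш(E/ℚ)` finite; `T = T₂E`, `V = T ⊗ ℚ`;
`G_∞ = Gal(ℚ(ζ_{2^∞})/ℚ) = Δ × U`; `Λ = ℤ₂[[G_∞]]`, `Λ' = ℤ₂[[Gal(ℚ^cyc/ℚ)]] ≅ ℤ₂[[X]]`; Kato's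
`𝐇^q(T) = lim_n H^q(ℤ[ζ_{2^n},1/2], T)`, `𝐇'^q(T) = lim_m H^q(ℤ_m[1/2], T)`; `K_∞ := ℚ₂(ζ_{2^∞})` (the LOCAL
cyclotomic field at `2`; `2` is totally ramified in `ℚ(ζ_{2^n})`, so `Gal(K_∞/ℚ₂) = G_∞`), `H := Gal(ℚ̄₂/K_∞)`.
Kato's local term (Thm. 12.5 (3), p. 222): `𝐇²_loc(V_{F_λ}(f)) = lim_n H²(ℚ(ζ_{p^n}) ⊗ ℚ_p, V_{F_λ}(f))`, and for
a lattice `T`, `𝐇²_loc(T)` likewise, `𝐇²_loc(V) = 𝐇²_loc(T) ⊗ ℚ`.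

## T15 — the local term of Thm. 12.5 (3) at an ADDITIVE `2` (Kato 13.13 verbatim + Tate's uniformisation)

* **T15 (a) (Kato 13.13, p. 233, VERBATIM).** «Assume `𝐇²_loc(V_{F_λ}(f))_𝔭 ≠ 0`. Let `T` be a
  `Gal(ℚ̄_p/ℚ_p)`-stable `O_λ`-lattice of `V_{F_λ}(f)`. By Tate's local duality, the Pontrjagin dual of
  `𝐇²_loc(T)` is isomorphic to `C := H⁰(ℚ_p(ζ_{p^∞}), Hom_{O_λ}(T, F_λ/O_λ)(1))`. If `𝐇²_loc(V_{F_λ}(f))_𝔭 ≠ 0`,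
  `𝐇²_loc(T)` is not finite, and hence `C` contains an `O_λ`-submodule which is isomorphic to `F_λ/O_λ`.»
  CONTRAPOSITIVE (pure logic): if `C` is FINITE then `𝐇²_loc(T) ≅ C^∨` is finite, so
  `𝐇²_loc(V) = 𝐇²_loc(T) ⊗ ℚ = 0` and the local term of Thm. 12.5 (3) vanishes at EVERY height-one prime `𝔭`
  of `Λ` — in particular at the primes `𝔭₊(𝔮)` (`𝔮 ∌ 2` a height-one prime of `Λ'`) used in T3. This is the
  ONLY property of «potentially good» that T3 (and item 7 of the odd-`p` sibling) uses; Kato's (12.5.1)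
  «if `𝐇²_loc(V)_𝔭 ≠ 0` then `f` is not potentially of good reduction at `p`» is the special case «potentially
  good ⟹ `C` finite» of what follows.
* **T15 (b) (identifying `C` for `T = T(f) = T₂E(−1)`; as in T12).** With `k = 2` and Kato's
  `V_{F_λ}(f)(1) ≅ V₂E` (14.10), the lattice of the readings is `T(f) = T₂E(−1)` (Remark 12.8: with `E[2]`
  irreducible every stable lattice is `2^k·T(f)`; `#C` changes by a finite amount under `T ↦ 2^kT`, so finiteness
  of `C` is lattice-independent). `Hom(T₂E(−1), ℚ₂/ℤ₂)(1) = Hom(T₂E, ℚ₂/ℤ₂)(2) ≅ E[2^∞](1)` (Weil pairing: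
  `Hom(T₂E, ℚ₂/ℤ₂(1)) ≅ E[2^∞]`, Silverman *AEC* III.8), and the cyclotomic character is TRIVIAL on
  `H = Gal(ℚ̄₂/K_∞)`, so as an abelian group `C ≅ H⁰(K_∞, E[2^∞]) = E(K_∞)[2^∞]`, the `2`-power torsion of `E`
  rational over `K_∞ = ℚ₂(ζ_{2^∞})`. HENCE: `E(ℚ₂(ζ_{2^∞}))[2^∞]` finite ⟹ the local term of Thm. 12.5 (3) is `0`
  at every height-one `𝔭`.
* **T15 (c) (LEMMA — Tate's uniformisation; Silverman *ATAEC* V.5.2, V.5.3, proof of V.5.4, Ex. 5.11).** Let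
  `E/ℚ₂` be an elliptic curve with ADDITIVE reduction and `|j(E)|₂ > 1` (potentially multiplicative). By Thm.
  V.5.3 (Tate) there is `q ∈ ℚ₂^×`, `|q|₂ < 1`, with `E ≅ E_q` over `ℚ̄₂`, and with `γ := γ(E/ℚ₂) = −c₄/c₆ ∈
  ℚ₂^×/ℚ₂^{×2}` (Lemma V.5.2; well defined since `j ≠ 0, 1728`) and `L := ℚ₂(√γ)`, `ψ : Gal(ℚ̄₂/ℚ₂) → Gal(L/ℚ₂)
  → {±1}` its quadratic character, there is an isomorphism `ψ_E : E_q → E` over `L` with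
  `ψ_E(P^σ) = ψ(σ)·ψ_E(P)^σ` (ATAEC p. 442, proof of Cor. V.5.4; Lemma V.5.2 (c)); i.e. on torsion
  `E[2^∞] ≅ E_q[2^∞] ⊗ ψ` as `Gal(ℚ̄₂/ℚ₂)`-modules. `E` is split multiplicative iff `γ = 1` iff `L = ℚ₂`
  (Thm. V.5.3 (b)); non-split multiplicative iff `L/ℚ₂` is unramified quadratic; ADDITIVE iff `L/ℚ₂` is RAMIFIED
  quadratic (Ex. 5.11 (a)(b)(c)) — so here `ψ` is a ramified quadratic character. The torsion of the Tate curve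
  (ATAEC V.3, `E_q(ℚ̄₂) ≅ ℚ̄₂^×/q^ℤ`): `0 → μ_{2^∞} → E_q[2^∞] → ℚ₂/ℤ₂ → 0` (`E_q[2^n]` is generated by `ζ_{2^n}`
  and `q^{1/2^n}`). Restrict to `H = Gal(ℚ̄₂/K_∞)`, on which `μ_{2^∞}` is a TRIVIAL module. CASE `ψ|_H ≠ 1`: then
  `H` acts on `μ_{2^∞} ⊗ ψ` and on `ℚ₂/ℤ₂ ⊗ ψ` through the non-trivial character `ψ|_H` with values `±1`, whose
  invariants are the elements `x` with `−x = x`, i.e. the `2`-torsion: `(μ_{2^∞} ⊗ ψ)^H = μ₂` and the image of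
  `(E[2^∞])^H` in `(ℚ₂/ℤ₂ ⊗ ψ)^H = ½ℤ/ℤ` has order `≤ 2`; hence `#E(K_∞)[2^∞] = #(E_q[2^∞] ⊗ ψ)^H ≤ 4` — FINITE.
  CASE `ψ|_H = 1`: `E(K_∞)[2^∞] ⊇ μ_{2^∞} ⊗ ψ` is infinite (not used). Finally, `ψ|_H = 1` iff `ψ` factors through
  `Gal(K_∞/ℚ₂) ≅ ℤ₂^× ≅ {±1} × (1 + 4ℤ₂)` iff `L ⊂ K_∞ = ℚ₂(ζ_{2^∞})` iff `L` is one of the THREE quadratic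
  subextensions `ℚ₂(√−1), ℚ₂(√2), ℚ₂(√−2)` of `ℚ₂(ζ_{2^∞})/ℚ₂` (the three index-`2` closed subgroups of `ℤ₂^×`; all
  three fields lie in `ℚ₂(ζ₈) = ℚ₂(√−1, √2)`) iff `γ(E/ℚ₂) ∈ {−1, 2, −2}·ℚ₂^{×2}` iff — since the quadratic twist
  `E^{(d)}` (`y² = x³ + d²Ax + d³B` for `E : y² = x³ + Ax + B`; the tree's `WeierstrassCurve.quadraticTwist`, isomorphic
  to `E` over `ℚ₂(√d)`) has `c₄(E^{(d)}) = d²c₄`, `c₆(E^{(d)}) = d³c₆`, `γ(E^{(d)}/ℚ₂) = d⁻¹γ(E/ℚ₂) ≡ d·γ(E/ℚ₂)`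
  and `j(E^{(d)}) = j(E)` — `γ(E^{(d)}/ℚ₂) = 1` for some `d ∈ {−1, 2, −2}` iff (Thm. V.5.3 (b), `|j(E^{(d)})|₂ =
  |j(E)|₂ > 1`) **`E^{(d)}` has SPLIT multiplicative reduction at `2` for some `d ∈ {−1, 2, −2}`**. CONCLUSION:
  for `E/ℚ₂` additive and potentially multiplicative, `E(ℚ₂(ζ_{2^∞}))[2^∞]` is finite iff (NST); for `E/ℚ₂`
  additive and potentially GOOD, `E(ℚ₂(ζ_{2^∞}))[2^∞]` is finite (Kato's (12.5.1) as printed — proof 13.13 via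
  the Frobenius weights on `D_crys` [Sa2]; independently Imai 1975: `A(K(μ_{p^∞}))_tors` is finite for an abelian
  variety with potentially good reduction over a `p`-adic field `K`) and (NST) holds trivially (no twist of a
  potentially good curve is multiplicative). So for every ADDITIVE `E` at `2`: **(NST) ⟹ `C` finite ⟹ the local
  term of Thm. 12.5 (3) vanishes at every height-one `𝔭`**, which is all that T3 needs.

## The other steps (why nothing else distinguishes potentially good from potentially multiplicative among ADDITIVE curves)

T1/T1′ (archimedean): sign of `Δ_E` only. T2/T11 (torsion-freeness and freeness of `𝐇'¹`, `𝐇¹` over `Λ'`, `Λ_U`;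
13.8): (12.2.1) and Thm. 12.4 (2) are printed for every `f`, and the regular-sequence step uses only
`H⁰(ℚ, E[2]) = H⁰(ℚ(i), E[2]) = 0` (irreducibility). T3 apart from the local term: Thm. 12.4 (1), Thm. 12.5 (2)(3)
via Thm. 13.4 (2) / Kato 1999 Thm. 0.8 (no reduction hypothesis), and 14.13 (`𝐇²(V)_𝔭 = 0`,
`(𝐇¹(V)/Z(f))_𝔭 = 0` at `𝔭 = ker(Λ → O_λ, σ_c ↦ c^r)`, `r = 1`, from `L(E,1) ≠ 0` via `exp*`, p. 242: printed
for every `f`; note that this prime is never the exceptional prime `ker(κ^{−2}χ)` of (12.5.1), `χ` of finite order,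
so even Kato's own 14.13 does not need potentially good — consistently, Thm. 14.2 carries no such hypothesis).
T4/T4′ (the `μ`-part = statement (A); Lim's lemma): the `2`-adic local term `⊕_{w∣2} H⁰(ℚ^cyc_w, E[2^∞])^∨` of the
limit Poitou–Tate sequence is `ℤ₂`-finitely generated for EVERY `E` (a subquotient of `T₂E^∨`-rank `≤ 2`), which is
all that is used. T5/T12 (integrality, Thm. 12.6 + 13.14): printed for every `f` («Let `T = V_{O_λ}(f)` …
`Z ⊂ Z(f,T)` and `Z(f,T)/Z` is a finite group», p. 222). T6/T6′ (descent 14.14 + Lemma 14.15): formal.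
T7/T7′ (Prop. 14.16 (2) / the Poitou–Tate count): local conditions `H¹_f` at `2`, `H¹_ur` at `ℓ`, formal.
**T8 (the local index at the ADDITIVE `2`)**: uses `E(ℚ₂) ⊗ ℤ₂ ≅ ℤ₂ × E(ℚ₂)[2^∞]` (any `E/ℚ₂`), the formal
logarithm on `Ê(4ℤ₂)` (any minimal model), and Tate's measure `μ_ω(E(ℚ₂)) = c₂·#Ẽ_ns(𝔽₂)/2` with
`#Ẽ_ns(𝔽₂) = #𝔾_a(𝔽₂) = 2` for ADDITIVE reduction — Kodaira types `I_n^*` (potentially multiplicative) included: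
the identity component of the special fibre of the Néron model of an additive curve is `𝔾_a` (Tate 1975 §1 /
*AEC* VII.5, *ATAEC* IV.9 Table 4.1). **T9 (the period, Thm. 12.5 (1))**: `L_{(2)}(E,1) = L(E,1)` because `a₂(E) = 0`
for ADDITIVE reduction (the Euler factor at `2` is `1`), potentially multiplicative included. T10 (from `S(T)` to
`Ш`): local terms at `ℓ ≠ 2` and the condition `H¹_f` at `2`, formal. T13–T14 (complex conjugation and descent
of `c`-invariant classes): Thm. 12.5 (1)'s last clause and `E(ℚ(ζ_{2^{m+2}}))[2] = 0` (irreducibility).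

## The count

UNCHANGED: T1–T14 / T1′–T7′ of the two earlier files word for word, with «the local term `𝐇²_loc` of 12.5 (3) is
`0` at a potentially good `p`, (12.5.1)» in T3 replaced by «the local term `𝐇²_loc` of 12.5 (3) is `0` because
`E(ℚ₂(ζ_{2^∞}))[2^∞]` is finite, 13.13 + T15». TOTAL: `ord₂ #Ш(E/ℚ)[2^∞] + Σ_ℓ v₂(c_ℓ) ≤ ord₂(L(E,1)/Ω_E)` for
either sign of `Δ_E` — the statement typed below.

WHAT IS NOT CLAIMED. Statement (A) is NOT asserted (hypothesis); nothing for reducible `E[2]`, for CM curves, in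
analytic rank `1`, or for the additive curves VIOLATING (NST): there the local term is `Λ/𝔭'` with
`𝔭' = ker(κ^{−1}ψ : Λ → ℤ₂)` (for the lattice `T₂E`; length `1` by (12.5.1)), `ψ = χ_d` the character of
`ℚ(√d)`, `d ∈ {−1, 2, −2}` the class with `E^{(d)}` split multiplicative; for `d = 2` this prime has `σ_{−1} ↦
−χ₂(−1) = −1`, so it lies OUTSIDE the `e₊`-localisations `𝔭₊(𝔮)` of T3 and the same conclusion is EXPECTED (it
would follow from the finiteness of `E_q(ℚ₂^cyc)[2^∞]`, `ℚ₂^cyc` the cyclotomic `ℤ₂`-extension of `ℚ₂`) —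
RECORDED, NOT CLAIMED; for `d ∈ {−1, −2}` (`σ_{−1} ↦ +1`) the argument gives only the weaker
`… ≤ ord₂ q + v₂(𝔮'(0))` (`= + 2`, resp. `+ 1`, for `γ ↔ 5`) — NOT CLAIMED. No lower bound. The non-verbatim
steps are T15 (b)(c) above and those listed in the two earlier files; the verbatim inputs are Kato's (12.2.1),
Thm. 12.4 (2), Thm. 12.5 (1)(3), (12.5.1), Thm. 12.6, 13.8, 13.9, 13.13 (incl. «the Pontrjagin dual of `𝐇²_loc(T)`
is isomorphic to `H⁰(ℚ_p(ζ_{p^∞}), Hom_{O_λ}(T, F_λ/O_λ)(1))`»), 13.14, 14.13–14.16. Never stronger than what these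
arguments give; no `_holds` (size XL). Derivation memo:
`run/shared/lean/pub/bsd-2adic/addL2x/VERDICT-19098-addL2x-GEN13.md`.

RELATION TO THE EARLIER FACTS (recorded Summits-side by the first consumer, pure logic + `j(E^{(d)}) = j(E)` +
*AEC* VII.5.1 (b)): this fact IMPLIES
`rankZero_padicValNat_sha_add_padicValNat_tamagawa_le_at_two_of_irreducible_of_fineSelmerDual_fg` (and hence the
two `+ 1` readings), because an additive potentially good `W` satisfies (NST).

THE LEAN STATEMENT. Exactly the SHARP fact of the sibling file with the hypothesis `0 ≤ padicValRat 2 W.j`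
REPLACED by (NST): `∀ d : ℚ, d = -1 ∨ d = 2 ∨ d = -2 → ¬ (W.quadraticTwist d).HasSplitMultiplicativeReductionAtPrime 2`
(the tree's `WeierstrassCurve.quadraticTwist` — the model `y² = x³ + d(b₂/4)x² + d²(b₄/2)x + d³(b₆/4)`,
isomorphic to `W` over `ℚ(√d)` — and `WeierstrassCurve.HasSplitMultiplicativeReductionAtPrime` — the
`ℤ₂`-minimal model of the curve over `ℚ₂` has split multiplicative reduction; both model-independent notions).

## References

* K. Kato, Astérisque 295 (2004): (12.2.1) (p. 220), Thm. 12.4 (2) (p. 221), Thm. 12.5 (1)(3), (12.5.1)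
  (pp. 221–222), Thm. 12.6, Remark 12.7, Remark 12.8 (pp. 222–223), 13.8 (pp. 227–229), 13.9 (pp. 229–230),
  **13.13 (p. 233: the local term and its Pontryagin dual; p. 234: (13.13.1), `k = 2`, `r = −1`, corank `1`)**,
  13.14 (p. 234), Thm. 14.2 (p. 235), 14.10, 14.13 (pp. 241–242), 14.14–14.16 (pp. 243–245). [Kato2004Asterisque]
* K. Kato, Kodai Math. J. 22 (1999) 313–372, Thm. 0.8. [Kato1999Kodai]
* J. H. Silverman, *Advanced Topics in the Arithmetic of Elliptic Curves*, GTM 151 (1994): V.3 (the Tate curve,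
  `E_q(K̄) ≅ K̄^×/q^ℤ`), Lemma V.5.2 (the invariant `γ(E/K) = −c₄/c₆`), Thm. V.5.3 (Tate's uniformisation; split
  iff `γ = 1`), proof of Cor. V.5.4 (p. 442: `ψ(P^σ) = χ(σ)ψ(P)^σ`), Exercise 5.11 (a)(b)(c) (split / non-split /
  additive iff `K(√γ)/K` trivial / unramified / ramified), IV.9 Table 4.1. [SilvermanATAEC1994]
* J. H. Silverman, *AEC* (2nd ed.), III.8 (Weil pairing), VII.5.1 (b) (`|j| > 1` at a multiplicative prime),
  X.5.4 (twists). [SilvermanAEC2009]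
* H. Imai, Proc. Japan Acad. 51 (1975) 12–16 (finiteness of torsion over `K(μ_{p^∞})` for potentially good
  reduction; independent of Kato's (12.5.1)). [Imai1975]
* J. Coates, R. Sujatha, Math. Ann. 331 (2005) 809–839, statement (A). [CoatesSujatha2005]
* M. F. Lim, Asian J. Math. 21 (2017) 337–362, §3. [Lim2017FineSelmer]
-/

noncomputable section

open scoped Classical

namespace Literature.NumberTheory.EllipticCurves.Kato2004

open WeierstrassCurve

/-- **Kato's Euler-system bound at an ADDITIVE `2` (potentially good or potentially multiplicative), in analytic
rank `0`, for IRREDUCIBLE `E[2]` and either sign of the discriminant, GRANTED Coates–Sujatha's statement (A) at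
`(E, 2)`, under «NO quadratic twist by `−1`, `2`, `−2` is split multiplicative at `2`» — SHARP form:
`ord₂ #Ш(E/ℚ)[2^∞] + v₂(∏_ℓ c_ℓ) ≤ ord₂(L(E,1)/Ω_E)`.** The SHARP reading of the sibling file with its ONE use of
«potentially good at `2`» — the vanishing of the local term `𝐇²_loc` of Kato's **Thm. 12.5 (3)** in step T3,
i.e. Kato's **(12.5.1)** — replaced by Kato's own computation of that term in **13.13** (p. 233): «the Pontrjagin
dual of `𝐇²_loc(T)` is isomorphic to `H⁰(ℚ_p(ζ_{p^∞}), Hom_{O_λ}(T, F_λ/O_λ)(1))`; if `𝐇²_loc(V)_𝔭 ≠ 0`,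
`𝐇²_loc(T)` is not finite», which for `T = T(f) = T₂E(−1)` is the group `E(ℚ₂(ζ_{2^∞}))[2^∞]` (Weil pairing;
the cyclotomic character dies on `Gal(ℚ̄₂/ℚ₂(ζ_{2^∞}))`, T15 (b)); and by Tate's uniformisation (Silverman
*ATAEC* Lemma V.5.2, **Thm. V.5.3**, proof of Cor. V.5.4, Ex. 5.11: an additive potentially multiplicative `E/ℚ₂`
is `E_q ⊗ ψ` with `ψ` the RAMIFIED quadratic character of `ℚ₂(√γ)`, `γ = −c₄/c₆`, and `E_q[2^∞]` is an extension
of `ℚ₂/ℤ₂` by `μ_{2^∞}`) that group is finite — of order `≤ 4` — unless `ψ` is trivial on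
`Gal(ℚ̄₂/ℚ₂(ζ_{2^∞}))`, i.e. unless `ℚ₂(√γ) ∈ {ℚ₂(√−1), ℚ₂(√2), ℚ₂(√−2)}`, i.e. unless the twist `E^{(d)}` is
SPLIT multiplicative at `2` for some `d ∈ {−1, 2, −2}` (T15 (c)); for potentially good `E` the group is finite by
(12.5.1) itself (or Imai 1975) and the hypothesis holds vacuously. Everything else — **(12.2.1)**, **Thm. 12.4 (2)**,
**13.8** over `Λ'` and over `Λ_U` (freeness from `H⁰(ℚ(i), E[2]) = 0`), **Thm. 12.6** + **13.14** (integrality),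
**Thm. 12.5 (1)** incl. `z_{ι(γ)} = −σ_{−1}(z_γ)` (**13.9**; `z' = 2y'`), **Thm. 12.5 (3)** at `2` via Kato 1999
Thm. 0.8, **14.13** (which never meets the exceptional prime of (12.5.1)), **14.14 + Lemma 14.15**, **Prop. 14.16**
or the Poitou–Tate count with the real place inserted, the local index at the ADDITIVE `2` (`Ẽ_ns = 𝔾_a` for
every additive Kodaira type, `I_n^*` included), the period `Ω⁺_γ = Ω_E/2`, `L_{(2)}(E,1) = L(E,1)` (`a₂ = 0`) — is
the earlier files' T1–T14 / T1′–T7′ word for word (module docstring: T15, «the other steps», what is not claimed).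
Let `W/ℚ` be a globally minimal NON-CM elliptic curve with ADDITIVE reduction at `2`, such that for NO
`d ∈ {−1, 2, −2}` the quadratic twist `W^{(d)}` has split multiplicative reduction at `2`, with `E[2]` irreducible,
`L(E,1) ≠ 0`, `Ш(E/ℚ)` finite, and assume (`hA`) that for every cyclotomic `ℤ₂`-extension datum `κ` of `ℚ` some
Pontryagin-dual datum `D` of `Sel₀(ℚ^cyc, E[2^∞])` has `ℤ₂`-finitely generated underlying module. Then there is
`q ∈ ℚ` with `L(E,1)/Ω(W) = q` and `ord₂ #Ш(E/ℚ)(2) + v₂(Tam(W)) ≤ ord₂ q`. A READING (non-verbatim steps T15 (b)(c)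
and those of the earlier files, written out in the module docstrings); never stronger than what the arguments give;
nothing claimed for the curves with a split multiplicative twist by `−1`, `2` or `−2`; no `_holds` (size XL). Flag
for the referee: `Kato-12.4(2)-12.5(1)(3)-12.6-13.8-13.13-13.14-14.14-at-two-additive-noSplitCycTwist-irreducible-fineSelmer-fg-sharp`.
[cite: Kato2004Asterisque, (12.2.1) (p. 220), Thm. 12.4 (2) (p. 221), Thm. 12.5 (1) incl. its last clause (p. 221), Thm. 12.5 (3) and (12.5.1) (p. 222), Thm. 12.6 and Remarks 12.7–12.8 (pp. 222–223), 13.8 (pp. 227–229), 13.9 (pp. 229–230), 13.13 (pp. 233–234: the Pontrjagin dual of the local term; (13.13.1), k = 2, r = −1), 13.14 (p. 234), 14.13 (p. 242), 14.14 and Lemma 14.15 (pp. 243–244), Prop. 14.16 (2) (pp. 244–245)]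
[cite: Kato1999Kodai, Thm. 0.8 (p. 318)]
[cite: SilvermanATAEC1994, V.3; Lemma V.5.2; Thm. V.5.3; proof of Cor. V.5.4 (p. 442); Exercise 5.11 (a)(b)(c); IV.9 Table 4.1]
[cite: SilvermanAEC2009, III.8, Prop. VII.5.1 (b), X.5 Cor. 5.4, IV.6.4, Thm. X.4.14]
[cite: Imai1975, Theorem (torsion over K(μ_{p^∞}) for potentially good reduction)]
[cite: BrunsHerzog1998, Thm. 1.3.3, Prop. 1.4.1]
[cite: NeukirchSchmidtWingberg2008, (1.6.7), (1.5.6)–(1.5.7)]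
[cite: Rubin2000, Ch. I §3 and Thm. I.7.3; Ch. III §5]
[cite: Lim2017FineSelmer, §3] [cite: CoatesSujatha2005, statement (A) (introduction and §3)]
[cite: BlochKato1990, §3 Def. 3.10, Ex. 3.11, Prop. 3.8]
[cite: Tate1975, §1] [cite: GreenbergLNM1716, Prop. 4.13] -/
def rankZero_padicValNat_sha_add_padicValNat_tamagawa_le_at_two_of_noSplitCyclotomicTwist_of_irreducible_of_fineSelmerDual_fg :
    Prop :=
  ∀ (W : WeierstrassCurve ℚ) [W.IsElliptic] [W.IsGloballyMinimal], ¬ W.HasCM →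
    ¬ W.HasGoodReductionAtPrime 2 → ¬ W.HasMultiplicativeReductionAtPrime 2 →
    (∀ d : ℚ, d = -1 ∨ d = 2 ∨ d = -2 →
      ¬ (W.quadraticTwist d).HasSplitMultiplicativeReductionAtPrime 2) →
    W.HasIrreducibleModPGaloisRep 2 →
    (∀ (κ : ZpExtension ℚ 2), κ.IsCyclotomic →
      ∃ (γ : Field.absoluteGaloisGroup ℚ) (D : W.FineSelmerDualData κ γ),
        Module.Finite ℤ_[2] (RestrictScalars ℤ_[2] (IwasawaAlgebra 2) D.X)) →
    W.entireLFunction 1 ≠ 0 → Finite W.sha →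
    ∃ q : ℚ, W.entireLFunction 1 / (W.realPeriodRat : ℂ) = (q : ℂ) ∧
      (padicValNat 2 (Nat.card (AddCommGroup.primaryComponent W.sha 2)) : ℤ) +
          padicValNat 2 W.tamagawaProduct ≤ padicValRat 2 q

end Literature.NumberTheory.EllipticCurves.Kato2004

end


/-! ## APPEND (same seat, same GEN, 2026-08-28): the twist by `2` — the local term at a `σ_{−1} = −1` prime is invisible to the `ℚ^cyc`-tower; the bound under the weaker hypothesis «no split multiplicative twist by `−1` or `−2` at `2`»

WHY. The fact above excludes the additive curves `E` with `E^{(2)}` split multiplicative at `2` (census: 36 classes),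
for which Kato's local term does NOT vanish: `E ≅ E_q ⊗ χ₂` over `ℚ₂` (T15 (c) with `ψ = χ₂`, the character of
`ℚ₂(√2)/ℚ₂`), `χ₂` is trivial on `H = Gal(ℚ̄₂/ℚ₂(ζ_{2^∞}))` (`√2 = ζ₈ + ζ₈⁻¹`), so `C = E(ℚ₂(ζ_{2^∞}))[2^∞] ⊇ μ_{2^∞}` is
infinite. This append records that step T3 never meets that local term, so the SAME conclusion holds. ONE named fact
(`def … : Prop`), the fact above with (NST) weakened to (NST′) «no split multiplicative twist by `−1` or `−2` at `2`»;
it implies the fact above (pure logic, recorded Summits-side). Flag for the referee (audit together with the fact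
above): `Kato-12.5(1)(3)-(12.5.1)-13.13-T3-at-two-additive-noSplitTwistNegOneNegTwo-irreducible-fineSelmer-fg-sharp`.

* **T16 (a) (Kato 13.13, pp. 233–234, VERBATIM: the local term when it does not vanish).** In the situation of
  (12.5.1) Kato proves: `V_{F_λ}(f)` has a rank-one quotient `U` on which `Gal(ℚ̄_p/ℚ_p(ζ_{p^n}))` acts by `κ^r`,
  «`k = 2` and `r = −1` and `f` is not potentially of good reduction at `p`. Furthermore, the `O_λ`-module `C` has
  `O_λ`-corank `1`. (If it has corank `2`, the action of `Gal(ℚ̄_p/ℚ_p)` on `V_{F_λ}(f)` factors through `G_∞`, and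
  then by Serre [Se2, Chap. III, Appendix], `V_{F_λ}(f)` should be potentially of good reduction at `p`.) By duality,
  `𝐇²_loc(V_{F_λ}(f))` is a one-dimensional `F_λ`-vector space, and is isomorphic to `U(−1)` as a `Λ`-module», and
  (12.5.1) (p. 222) names its support: «`𝔭` is the kernel of the ring homomorphism `Λ → F_λ` induced by
  `κ^{−2}χ : G_∞ → F_λ^×` for some homomorphism `χ : G_∞ → F_λ^×` of finite order, and
  `length_{Λ_𝔭}(𝐇²_loc(V_{F_λ}(f))_𝔭) = 1`». For `E ≅ E_q ⊗ ψ` over `ℚ₂` (`ψ` quadratic, T15 (c)):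
  `V₂E|_{G_{ℚ₂}}` is the NON-split extension `0 → ψκ → V₂E → ψ → 0` (the Tate curve; the extension class is the
  Kummer class of `q`, `v(q) > 0`, Silverman *ATAEC* V.3/V.5), so `V(f) = V₂E(−1)` has the unique rank-one quotient
  `U = ψκ^{−1}` (`r = −1`, `χ = ψ` viewed on `G_∞ = Gal(ℚ₂(ζ_{2^∞})/ℚ₂)` — possible exactly when `ψ|_H = 1`, i.e.
  `ψ ∈ {χ_{−1}, χ₂, χ_{−2}}`), and `𝐇²_loc(V(f)) ≅ U(−1) = F_λ(ψκ^{−2})`: the local term of Thm. 12.5 (3) for `V(f)`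
  is supported at the single height-one prime `𝔭_f = ker(κ^{−2}ψ)` (`∌ 2`) with length `1`, and
  `𝐇²_loc(V(f))_𝔭 = 0` at every other height-one prime `𝔭` (`(Λ/𝔭_f)_𝔭 = 0` for `𝔭 ≠ 𝔭_f` of height one).
  [Consistency with T15 (b): `C ⊇ μ_{2^∞} ⊗ ψ ⊗ ℤ₂(1)` with `G_∞` acting by `κ²ψ`; `𝐇²_loc(T(f)) ≅ C^∨ ≅ ℤ₂(κ^{−2}ψ)`
  up to finite.]
* **T16 (b) (the lattice of the readings: shift by `κ`).** The readings run Thm. 12.5 (3) for `T = T₂E = T(f)(1)`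
  through the twist isomorphism `𝐇^q(T(f)) ⊗ ℤ₂(1) ≅ 𝐇^q(T(f)(1))` of T12–T13, which is `Λ`-semilinear for
  `σ ↦ κ(σ)σ`; under it a `Λ`-module supported at `ker(ρ)` goes to one supported at `ker(ρκ)`. Hence the local term
  for `V₂E` is supported at the single height-one prime **`𝔭' = ker(Λ → ℤ₂, σ ↦ κ(σ)^{−1}ψ(σ))`**, `𝔭' ∌ 2`, length
  `1`, and vanishes at every other height-one prime.
* **T16 (c) (the sign at `σ_{−1}`; elementary).** `σ_{−1} ∈ G_∞` is the element `−1 ∈ ℤ₂^× ≅ Gal(ℚ₂(ζ_{2^∞})/ℚ₂)`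
  (`ζ ↦ ζ^{−1}`): `κ(σ_{−1}) = −1`, and `ψ(σ_{−1})` is the action of `σ_{−1}` on `√d ∈ ℚ₂(ζ₈)`: `χ₂(σ_{−1}) = +1`
  (`√2 = ζ₈ + ζ₈^{−1}` is fixed), `χ_{−1}(σ_{−1}) = −1` (`i ↦ i^{−1} = −i`), `χ_{−2}(σ_{−1}) = −1`
  (`√−2 = ζ₈ + ζ₈³ ↦ ζ₈^{−1} + ζ₈^{−3} = −(ζ₈ + ζ₈³)`, as `ζ₈^{−1} = −ζ₈³`, `ζ₈^{−3} = −ζ₈`). So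
  `(κ^{−1}ψ)(σ_{−1}) = −ψ(σ_{−1})` is `−1` for `ψ = χ₂` and `+1` for `ψ ∈ {χ_{−1}, χ_{−2}}`. Step T3 applies Thm. 12.5 (3)
  ONLY at the primes `𝔭₊(𝔮) ⊂ Λ` (over the height-one primes `𝔮 ∌ 2` of `Λ'`) «on which `c = +1`», i.e. with
  `σ_{−1} − 1 ∈ 𝔭₊(𝔮)`: the localisation `Λ ⊗_{Λ'} Λ'_𝔮 = Λ'_𝔮 e₊ × Λ'_𝔮 e₋` and `(𝐇'^q)_𝔮 ≅ e₊(𝐇^q)_𝔮 = (𝐇^q)_{𝔭₊(𝔮)}`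
  (T3, unchanged). For `ψ = χ₂`: `σ_{−1} + 1 ∈ 𝔭'` and `2 ∉ 𝔭'`, so `σ_{−1} − 1 ∉ 𝔭'`, i.e. `𝔭' ≠ 𝔭₊(𝔮)` for EVERY
  `𝔮` — the local term of Thm. 12.5 (3) VANISHES at every prime that T3 uses, and T3 (hence T1–T14 / T1′–T7′ and the
  count) goes through word for word. [For `ψ ∈ {χ_{−1}, χ_{−2}}`: `𝔭' = 𝔭₊(𝔮')` with `𝔮' = 𝔭' ∩ Λ'` IS used by T3,
  the inequality there carries the local term of length `1`, and the count loses `v₂(𝔮'(0))` — NOT claimed, as in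
  the fact above.]
* **T16 (d) (the other steps for a curve with `E^{(2)}` split multiplicative).** Over the first layer `ℚ₁ = ℚ(√2)`
  of `ℚ^cyc` the curve `E ≅ E^{(2)}` becomes SPLIT MULTIPLICATIVE at the prime above `2`; nothing in T1–T14 /
  T1′–T7′ uses the reduction type of `E` over the layers `ℚ_m`, `m ≥ 1`: T8 (local index), T9 (`L_{(2)} = L`,
  `a₂ = 0`), T7/T7′, T10 (local conditions) are statements over `ℚ`, where `E` is ADDITIVE; T2/T11, T14 use only
  `H⁰(·, E[2]) = 0` over `ℚ`, `ℚ(i)`, `ℚ_m`, `ℚ(ζ_{2^n})` (irreducibility) and the finiteness of `E(F)[2^∞]` for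
  NUMBER FIELDS `F`; T4/T4′ use only that the `2`-adic local term `⊕_{w∣2} H⁰(ℚ^cyc_w, E[2^∞])^∨` of the limit
  Poitou–Tate sequence is `ℤ₂`-finitely generated (true for every `E`: a subquotient of `T₂E^∨` of `ℤ₂`-rank `≤ 2`;
  for `ψ = χ₂`, `μ_{2^∞}(ℚ₂^cyc) = {±1}` — `i ∉ ℚ₂^cyc` — so its divisible part is at most the Kummer quotient part,
  of corank `≤ 1`), which affects neither `μ(𝐇'²) = r_∞` under (A) nor T3's `λ`-part comparison (Kato's inequality
  at the `𝔭₊(𝔮)` is a theorem whatever `𝐇'²` contains); T5/T12 (Thm. 12.6), T6/T6′ (14.14–14.15), T13 (Thm. 12.5 (1))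
  are reduction-free.
* **The count.** UNCHANGED; TOTAL `ord₂ #Ш(E/ℚ)[2^∞] + Σ_ℓ v₂(c_ℓ) ≤ ord₂(L(E,1)/Ω_E)` under (NST′). Census (context
  only): (NST′) holds on 255 of the 463 potentially multiplicative classes (the 219 (NST) classes + the 36 with
  `d* = 2` split), fails on 208 (`d* = −1` split 169, `d* = −2` split 39).

WHAT IS NOT CLAIMED. As for the fact above, except that the curves with `E^{(2)}` split multiplicative at `2` ARE now
covered; nothing for a split multiplicative twist by `−1` or `−2` (there `… ≤ ord₂ q + 2`, resp. `+ 1`, only — NOT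
claimed); nothing for reducible `E[2]`, CM, analytic rank `1`; no lower bound; the finiteness of `E_q(ℚ₂^cyc)[2^∞]`
(the Kummer quotient part) is NOT used and NOT claimed. Non-verbatim steps: T16 (b)(c)(d) and those listed before;
verbatim: Kato (12.5.1) incl. the description of `𝔭` and `length = 1`, 13.13 incl. «`C` has corank `1`» and
«`𝐇²_loc(V) ≅ U(−1)` as a `Λ`-module». Derivation memo: `run/shared/lean/pub/bsd-2adic/addL2x/VERDICT-19098-addL2x-GEN13.md` §2.

THE LEAN STATEMENT. The fact above with `d = -1 ∨ d = 2 ∨ d = -2` replaced by `d = -1 ∨ d = -2`.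
-/

namespace Literature.NumberTheory.EllipticCurves.Kato2004

open WeierstrassCurve

/-- **Kato's Euler-system bound at an ADDITIVE `2`, in analytic rank `0`, for IRREDUCIBLE `E[2]`, GRANTED statement (A)
at `(E, 2)`, under «NO quadratic twist by `−1` or `−2` is split multiplicative at `2`» — SHARP form:
`ord₂ #Ш(E/ℚ)[2^∞] + v₂(∏_ℓ c_ℓ) ≤ ord₂(L(E,1)/Ω_E)`.** The fact above with its hypothesis (NST) weakened to (NST′):
the additive curves with `E^{(2)}` split multiplicative at `2` (`E ≅ E_q ⊗ χ₂` over `ℚ₂`) are INCLUDED. For them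
Kato's local term of **Thm. 12.5 (3)** does not vanish, but by **(12.5.1)** (p. 222) and **13.13** (pp. 233–234:
`V(f) ↠ U = ψκ^{−1}`, «`C` has corank `1`», «`𝐇²_loc(V) ≅ U(−1)` as a `Λ`-module», length `1`) it is supported at the
single height-one prime `ker(κ^{−2}χ₂)` of `Λ` for `V(f)`, i.e. at `𝔭' = ker(κ^{−1}χ₂)` for `V₂E = V(f)(1)` (the
`Λ`-semilinear twist of T12–T13), and `χ₂(σ_{−1}) = +1` (`σ_{−1}` fixes `√2 = ζ₈ + ζ₈^{−1}`), `κ(σ_{−1}) = −1` give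
`σ_{−1} + 1 ∈ 𝔭'`: a «`c = −1`» prime, whereas step T3 applies Thm. 12.5 (3) only at the «`c = +1`» primes
`𝔭₊(𝔮)` of the `e₊`-localisation `(𝐇'^q)_𝔮 ≅ (𝐇^q)_{𝔭₊(𝔮)}` — so the local term vanishes at every prime the reading
uses (T16 (a)–(c)); nothing else in T1–T14 / T1′–T7′ sees the reduction type above the base (T16 (d)). For twists
by `−1`, `−2` (`χ(σ_{−1}) = −1`, `𝔭' = 𝔭₊(𝔮')`) the local term IS met and nothing is claimed. Let `W/ℚ` be a globally
minimal NON-CM elliptic curve with ADDITIVE reduction at `2` such that neither `W^{(−1)}` nor `W^{(−2)}` has split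
multiplicative reduction at `2`, with `E[2]` irreducible, `L(E,1) ≠ 0`, `Ш(E/ℚ)` finite, and assume (`hA`) that
for every cyclotomic `ℤ₂`-extension datum `κ` of `ℚ` some Pontryagin-dual datum `D` of `Sel₀(ℚ^cyc, E[2^∞])` has
`ℤ₂`-finitely generated underlying module. Then there is `q ∈ ℚ` with `L(E,1)/Ω(W) = q` and
`ord₂ #Ш(E/ℚ)(2) + v₂(Tam(W)) ≤ ord₂ q`. A READING (non-verbatim steps T15 (b)(c), T16 (b)(c)(d) and those of the
earlier files); never stronger than what the arguments give; no `_holds` (size XL). Implies the fact above (pure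
logic). Flag for the referee:
`Kato-12.5(1)(3)-(12.5.1)-13.13-T3-at-two-additive-noSplitTwistNegOneNegTwo-irreducible-fineSelmer-fg-sharp`.
[cite: Kato2004Asterisque, Thm. 12.5 (1)(3) and (12.5.1) incl. the description of 𝔭 and length 1 (pp. 221–222), 13.13 (pp. 233–234: U with r = −1, C of corank 1, 𝐇²_loc(V) ≅ U(−1)), 13.8 (pp. 227–229), 13.14 (p. 234), 14.13–14.16 (pp. 242–245)]
[cite: Kato1999Kodai, Thm. 0.8 (p. 318)]
[cite: SilvermanATAEC1994, V.3; Lemma V.5.2; Thm. V.5.3; proof of Cor. V.5.4 (p. 442); Exercise 5.11 (a)(b)(c)]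
[cite: SilvermanAEC2009, III.8, Prop. VII.5.1 (b), X.5 Cor. 5.4]
[cite: CoatesSujatha2005, statement (A) (introduction and §3)] [cite: Lim2017FineSelmer, §3]
[cite: Rubin2000, Ch. I §3 and Thm. I.7.3; Ch. III §5] -/
def rankZero_padicValNat_sha_add_padicValNat_tamagawa_le_at_two_of_noSplitTwistNegOneNegTwo_of_irreducible_of_fineSelmerDual_fg :
    Prop :=
  ∀ (W : WeierstrassCurve ℚ) [W.IsElliptic] [W.IsGloballyMinimal], ¬ W.HasCM →
    ¬ W.HasGoodReductionAtPrime 2 → ¬ W.HasMultiplicativeReductionAtPrime 2 →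
    (∀ d : ℚ, d = -1 ∨ d = -2 →
      ¬ (W.quadraticTwist d).HasSplitMultiplicativeReductionAtPrime 2) →
    W.HasIrreducibleModPGaloisRep 2 →
    (∀ (κ : ZpExtension ℚ 2), κ.IsCyclotomic →
      ∃ (γ : Field.absoluteGaloisGroup ℚ) (D : W.FineSelmerDualData κ γ),
        Module.Finite ℤ_[2] (RestrictScalars ℤ_[2] (IwasawaAlgebra 2) D.X)) →
    W.entireLFunction 1 ≠ 0 → Finite W.sha →
    ∃ q : ℚ, W.entireLFunction 1 / (W.realPeriodRat : ℂ) = (q : ℂ) ∧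
      (padicValNat 2 (Nat.card (AddCommGroup.primaryComponent W.sha 2)) : ℤ) +
          padicValNat 2 W.tamagawaProduct ≤ padicValRat 2 q

end Literature.NumberTheory.EllipticCurves.Kato2004
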